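import Literature.Analysis.InnerProduct.HigherLensSpaceMultiplicity
import Literature.Analysis.InnerProduct.LensSpaceGeneratingFunction
import HarnessLib

/-!
# The residue of the generating function of the orbifold lens space `L(q; x, w)` at `γ^{−x}` in closed form:
# Bari–Hunsicker 2019, Proposition 3.2, and Theorem 3.1 Case 5 for two spaces in the normal form `L(q; x, w₁)`, `L(q; x, w₂)`

Layer `Literature/Analysis/InnerProduct`, namespace `Literature.Analysis.InnerProduct`; lane `lit-hodgefound`, prover seat
`lit-hodgefound-p06`, generation 46, row g46-#8. THEOREMS only (no definition, no instance, no notation, no named fact).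
Rows g46-#5/#6 treat Cases 2–4 of the source's three-dimensional theorem ("Two three-dimensional isospectral orbifold lens
spaces are isometric") by the residues at `γ^k`, `k` prime to `q`, and the pole `z = 1`. Case 5 — no weight prime to `q` —
needs the pole at `γ^x`, `x = gcd(p₁, q) > 1`: this file computes its residue IN CLOSED FORM and derives Proposition 3.2 and
the Case-5 congruence for two spaces sharing the first weight `x`; the reduction of general Case-5 weights to this normal
form (Lemma 3.3 of the source) is left to the next row.

## Source, verbatim (held text `paper:arxiv-1705.01412`)

N. Bari, E. Hunsicker, *Isospectrality for orbifold lens spaces*, Canad. J. Math. **72** (2020), arXiv:1705.01412, §3,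
Case 5: "This is the hardest of all the cases. … Let `gcd(p₁, q) = x > 1`, `gcd(p₂, q) = y > 1`, `gcd(s₁, q) = u > 1`, and
`gcd(s₂, q) = v > 1`. Also without loss of generality we can assume that `y > x` and `v > u` … we can multiply the entries of
`L₁` and `L₂` by appropriate numbers coprime to `q` and rewrite `L₁ = L(q:x, py)` and `L₂ = L(q:u, sv)` … We will also
assume that `gcd(x, py) = 1 = gcd(u, sv)` … **Proposition 3.2.** Suppose `L = L(q:x, py)` is an orbifold lens space with
spectrum generating function `F_q(z)`. Then `lim_{z→γ^x}(z − γ^x)F_q(z) ≠ 0`, where `γ = e^{2πi/q}` is a primitive `q`-th root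
of unity. Proof. We denote `q_{/x} = q/x` and `q_{/y} = q/y`. Then
`lim_{z→γ^x}(z − γ^x)F_q(z) = lim_{z→γ^x}(−γ^x/q)∑_{l=1}^{q}(1 − γ^{−x}z)(1 − z²)/((1 − γ^{xl}z)(1 − γ^{−xl}z)(1 − γ^{pyl}z)(1 −
γ^{−pyl}z))` (limit1). As before, the terms in the above sum are non-zero iff one of the following congruences has a solution:
(1″) `xl + x ≡ 0 (mod q)`, (2″) `−xl + x ≡ 0 (mod q)`, (3″) `pyl + x ≡ 0 (mod q)`, (4″) `−pyl + x ≡ 0 (mod q)`. (3″)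
implies that `pyl + x ≡ 0 (mod y)`, so, if (3″) has a solution, it would violate the fact that `gcd(x, y) = 1`. Therefore,
(3″) has no solution. Similarly (4″) has no solution. The solution to (1″) is `l = tq_{/x} − 1` and the solution to (2″) is
`l = tq_{/x} + 1` for `t ∈ {1, …, x}`. … We can, therefore, write (limit1) as
`lim_{z→γ^x}(z − γ^x)F_q(z) = (−2γ^x/q)∑_{t=1}^{x} 1/((1 − γ^{py(tq_{/x} − 1)+x})(1 − γ^{−py(tq_{/x} − 1)+x}))` …
[= `(1/(2q sin(2πx/q)))∑_{t=1}^{x}[cot(πa_t/q) − cot(πb_t/q)]` (eq:cot)] … (iii) `A_j = B_k`. This means … `y | 2x`, which is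
not possible since we are assuming that `gcd(x, y) = 1` and `x < y`. This proves the proposition." Lemma 3.3 and the Remark
after it reduce the two spaces to "`L₁ = L(q:x, py)` and `L₂ = L(q:x, sy)`", and the proof of Case 5 concludes: "Using a
similar argument as in Proposition 3.2 above and the fact that `F₁(z) = F₂(z)`, we will get [the equality (test3) of the two
cotangent sums] … These congruences imply `py[(t₁+t)q_{/x} − 1] ≡ sy[(t₂+t)q_{/x} − 1] (mod q)` (test4) … Now we see that the
corresponding lens spaces are isometric because `L(q; x, py) ∼ L(q; −x, −py) ∼ L(q; −x, (t₃q_{/x} − 1)sy) ∼ L(q; x, sy)`."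
[Condition (II) likewise with `−sy`.]

## As formalised — a closed form replaces the cotangent sums (documented deviation from the printed argument)

Notation: `q = xm` (`m = q_{/x}`), `e(t) = e^{2πit/q}`; the pole `γ^x` is treated at the conjugate root `e(−x) = γ^{−x}` (the
substitution `γ ↦ γ̄`, under which all statements are invariant); `(1 − e(x)z)` replaces `(z − γ^x)` (a nonzero constant factor).
The weight `w` plays the role of `py`; the hypotheses used are: `m ≥ 3`; `w` prime to `x` (the source's `gcd(x, py) = 1`);
`m ∤ lw − x` for every integer `l` (implied by `y ∤ x`: it makes (3″), (4″) unsolvable and `e(x(w ± x)) ≠ 1`); and, for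
Proposition 3.2 and Case 5, `m ∤ 2x` (the source's "`y | 2x` is not possible").
* §2–§3 (private): the `l`-th term of (3.8) times `1 − e(x)z` tends to `R(l) = 1/((1 − e(lw − x))(1 − e(−(lw + x))))` if
  `lx ≡ ±x`, i.e. `l ≡ ±1 (mod m)`, and to `0` otherwise; summing over `l = tm + r < q`: `∑_{t<x}(R(tm + 1) + R(tm + m − 1))`,
  and the second family equals the first (`l ↦ q − l`).
* §4 (private): partial fractions `R(l) = (1/(1 − e(−2x)))·(1/(1 − e(lw − x)) − 1/(1 − e(lw + x)))`, and the geometric sum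
  over the `x`-th roots of unity `e((tm + 1)w ± x) = e(w ± x)·ζ_x^{tw}`:
  `∑_{t<x} 1/(1 − Eζ_x^{tc}) = x/(1 − E^x)` for `E^x ≠ 1`, `c ≡ w` prime to `x`.
* §5 **`tendsto_one_sub_exp_mul_tsum_lensMultiplicity_axis`**:
  `(1 − e(x)z)·∑_n dim E_{n(n+2)}(L(q; x, w)) z^n → (2/q)·(1/(1 − e(−2x)))·(x/(1 − e(x(w − x))) − x/(1 − e(x(w + x))))`, and
  **`residue_axis_ne_zero`** = PROPOSITION 3.2: this is nonzero iff `e(x(w − x)) ≠ e(x(w + x))` iff `m ∤ 2x`.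
* §6 **`dvd_sub_or_dvd_add_of_lensMultiplicity_eq_axis`**: `L(q; x, w₁)`, `L(q; x, w₂)` isospectral ⟹ `w₁ ≡ ±w₂ (mod m)` —
  with `V = e(xw₁)`, `W = e(xw₂)`, `U = e(x²)` the equality of residues reads `1/(1 − VŪ) − 1/(1 − VU) = 1/(1 − WŪ) − 1/(1 −
  WU)`, i.e. `(Ū − U)(V − W)(1 − VW) = 0`; then **`exists_isCoprime_mul_congr_axis`** (the source's last step: `l = 1 + tm`,
  `t ≡ ((±w₁ − w₂)/m)·w₂⁻¹ (mod x)`, gives `l` prime to `q` with `lx ≡ x`, `lw₂ ≡ ±w₁ (mod q)`),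
  **`exists_isCoprime_mul_congr_of_lensMultiplicity_eq_axis`** (Case 5 in normal form: the isometry criterion of Corollary
  2.2 with `l` prime to `q`) and **`lensWeightsEquivalent_of_lensMultiplicity_eq_axis`** (Ikeda's `LensWeightsEquivalent`).

## References

* [BariHunsicker2019] N. Bari, E. Hunsicker, *Isospectrality for orbifold lens spaces*, Canad. J. Math. 72 (2020)
  (arXiv:1705.01412), §3: Proposition 3.2 and its proof ((limit1), (eq:cot)), Lemma 3.3 and Remark, proof of Theorem 3.1
  Case 5 ((test3), (test4), (eq:case2), the final isometries); §2.1 Corollary 2.2, Corollary 2.12.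
* [IkedaYamamoto1979] A. Ikeda, Y. Yamamoto, *On the spectra of 3-dimensional lens spaces*, Osaka J. Math. 16 (1979) 447–469,
  Theorem 3.2 (3.8), proof of Proposition 4.6 (the residue computation this file generalises).
* [Ikeda1980] A. Ikeda, *On lens spaces which are isospectral but not isometric*, Ann. Sci. ÉNS (4) 13 (1980) 303–315,
  Theorem 2.1 (4).
-/

noncomputable section

open Finset Filter Topology Complex

namespace Literature.Analysis.InnerProduct

open _root_.Real _root_.Filter _root_.Topology

/-! ### §1 Roots of unity `e(t) = e^{2πit/q}` and the two limit lemmas (private copies of the private helpers of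
`LensSpaceGeneratingFunctionResidues.lean`) -/

/-- `e(a)·e(b) = e(a + b)`. [folklore] -/
private theorem exp_intCast_mul_exp_intCast_x (q : ℕ) (a b : ℤ) :
    cexp (2 * π * I * a / q) * cexp (2 * π * I * b / q) = cexp (2 * π * I * ((a + b : ℤ) : ℂ) / q) := by
  rw [← Complex.exp_add]
  congr 1
  push_cast
  ring

/-- `e(a) = 1 ↔ q ∣ a`. [folklore] -/
private theorem exp_intCast_eq_one_iff_x {q : ℕ} (hq : q ≠ 0) (a : ℤ) :
    cexp (2 * π * I * a / q) = 1 ↔ (q : ℤ) ∣ a := by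
  have hq0 : (q : ℂ) ≠ 0 := Nat.cast_ne_zero.mpr hq
  have h2 : (2 * π * I : ℂ) ≠ 0 := by simp [Real.pi_ne_zero, I_ne_zero]
  constructor
  · intro h
    obtain ⟨n, hn⟩ := Complex.exp_eq_one_iff.mp h
    have h3 := congrArg (· * (q : ℂ)) hn
    simp only [div_mul_cancel₀ _ hq0] at h3
    have h4 : (2 * π * I) * (a : ℂ) = (2 * π * I) * (n * q) := by linear_combination h3
    have h5 := mul_left_cancel₀ h2 h4
    exact ⟨n, by exact_mod_cast h5.trans (mul_comm _ _)⟩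
  · rintro ⟨c, hc⟩
    rw [hc, show (2 * π * I * ((q * c : ℤ) : ℂ) / q) = c * (2 * π * I) by push_cast; field_simp]
    exact Complex.exp_int_mul_two_pi_mul_I c

/-- `e(a) = 1 ↔ a ≡ 0` in `ℤ/q`. [folklore] -/
private theorem exp_intCast_eq_one_iff_cast_x {q : ℕ} (hq : q ≠ 0) (a : ℤ) :
    cexp (2 * π * I * a / q) = 1 ↔ (a : ZMod q) = 0 := by
  rw [exp_intCast_eq_one_iff_x hq, ZMod.intCast_zmod_eq_zero_iff_dvd]

/-- `e(a) = e(b) ↔ a ≡ b` in `ℤ/q`. [folklore] -/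
private theorem exp_intCast_eq_iff_x {q : ℕ} (hq : q ≠ 0) (a b : ℤ) :
    cexp (2 * π * I * a / q) = cexp (2 * π * I * b / q) ↔ (a : ZMod q) = (b : ZMod q) := by
  have hb : cexp (2 * π * I * b / q) ≠ 0 := Complex.exp_ne_zero _
  rw [← div_eq_one_iff_eq hb, ← Complex.exp_sub, show 2 * π * I * (a : ℂ) / q - 2 * π * I * (b : ℂ) / q =
    2 * π * I * ((a - b : ℤ) : ℂ) / q by push_cast; ring, exp_intCast_eq_one_iff_cast_x hq, Int.cast_sub, sub_eq_zero]

/-- `e(a) = e(b)` when `a ≡ b` in `ℤ/q`. [folklore] -/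
private theorem exp_intCast_congr_x {q : ℕ} (hq : q ≠ 0) {a b : ℤ} (h : (a : ZMod q) = (b : ZMod q)) :
    cexp (2 * π * I * a / q) = cexp (2 * π * I * b / q) :=
  (exp_intCast_eq_iff_x hq a b).mpr h

/-- `|e(a)| = 1`. [folklore] -/
private theorem norm_exp_intCast_x (q : ℕ) (a : ℤ) : ‖cexp (2 * π * I * a / q)‖ = 1 := by
  rw [show (2 * π * I * a / q : ℂ) = ((2 * π * a / q : ℝ) : ℂ) * I by push_cast; ring]
  exact Complex.norm_exp_ofReal_mul_I _

/-- The tree's `e^{2πi·l·p/q}` of (3.8) is `e(lp)`. [folklore] -/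
private theorem exp_natCast_mul_intCast_x (q l : ℕ) (p : ℤ) :
    cexp (2 * π * I * l * p / q) = cexp (2 * π * I * (((l : ℤ) * p : ℤ) : ℂ) / q) := by
  congr 1
  push_cast
  ring

/-- The tree's `e^{−2πi·l·p/q}` of (3.8) is `e(−lp)`. [folklore] -/
private theorem exp_neg_natCast_mul_intCast_x (q l : ℕ) (p : ℤ) :
    cexp (-(2 * π * I * l * p / q)) = cexp (2 * π * I * ((-((l : ℤ) * p) : ℤ) : ℂ) / q) := by
  congr 1
  push_cast
  ring

/-- **No factor vanishes at `z₀`** (a term holomorphic at `z₀`): `(1 − γz)·(1 − z²)/D(z) → 0` as `z → z₀` when `γz₀ = 1`, `D`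
is continuous at `z₀` and `D(z₀) ≠ 0`. [folklore] -/
private theorem tendsto_mul_div_of_ne_zero_x {γ z₀ : ℂ} (hγ : γ * z₀ = 1) {D : ℂ → ℂ} (hD : ContinuousAt D z₀)
    (hD0 : D z₀ ≠ 0) :
    Tendsto (fun z : ℂ ↦ (1 - γ * z) * ((1 - z ^ 2) / D z)) (𝓝[≠] z₀) (𝓝 0) := by
  have h1 : Tendsto (fun z : ℂ ↦ 1 - γ * z) (𝓝 z₀) (𝓝 (1 - γ * z₀)) :=
    tendsto_const_nhds.sub (tendsto_const_nhds.mul tendsto_id)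
  rw [hγ, sub_self] at h1
  have h2 : Tendsto (fun z : ℂ ↦ (1 - z ^ 2) / D z) (𝓝 z₀) (𝓝 ((1 - z₀ ^ 2) / D z₀)) :=
    (tendsto_const_nhds.sub (tendsto_id.pow 2)).div hD.tendsto hD0
  have h3 := h1.mul h2
  rw [zero_mul] at h3
  exact h3.mono_left nhdsWithin_le_nhds

/-- `γz₀ = 1`, `z ≠ z₀ ⇒ 1 − γz ≠ 0`. [folklore] -/
private theorem one_sub_mul_ne_zero_of_ne_x {γ z₀ z : ℂ} (hγ : γ * z₀ = 1) (hz : z ≠ z₀) : 1 - γ * z ≠ 0 := by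
  intro h
  apply hz
  have hγ0 : γ ≠ 0 := by
    rintro rfl
    simp at hγ
  exact mul_left_cancel₀ hγ0 ((sub_eq_zero.mp h).symm.trans hγ.symm)

/-- **Exactly one factor vanishes at `z₀`** (a simple pole of the term): if `D(z) = (1 − γz)R(z)` with `γz₀ = 1`, `R` continuous
at `z₀` and `R(z₀) ≠ 0`, then `(1 − γz)·(1 − z²)/D(z) → (1 − z₀²)/R(z₀)` as `z → z₀`, `z ≠ z₀`. [folklore] -/
private theorem tendsto_mul_div_of_factor_x {γ z₀ : ℂ} (hγ : γ * z₀ = 1) {D R : ℂ → ℂ}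
    (hDR : ∀ z, D z = (1 - γ * z) * R z) (hR : ContinuousAt R z₀) (hR0 : R z₀ ≠ 0) :
    Tendsto (fun z : ℂ ↦ (1 - γ * z) * ((1 - z ^ 2) / D z)) (𝓝[≠] z₀) (𝓝 ((1 - z₀ ^ 2) / R z₀)) := by
  have h2 : Tendsto (fun z : ℂ ↦ (1 - z ^ 2) / R z) (𝓝 z₀) (𝓝 ((1 - z₀ ^ 2) / R z₀)) :=
    (tendsto_const_nhds.sub (tendsto_id.pow 2)).div hR.tendsto hR0
  refine (h2.mono_left nhdsWithin_le_nhds).congr' ?_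
  filter_upwards [self_mem_nhdsWithin, mem_nhdsWithin_of_mem_nhds (hR.eventually_ne hR0)] with z hz hRz
  have hz' := one_sub_mul_ne_zero_of_ne_x hγ hz
  have hz'' : 1 - z * γ ≠ 0 := by rwa [mul_comm] at hz'
  rw [hDR z]
  field_simp

/-- `∑_{x ∈ ℤ/q} F(x̃) = ∑_{l < q} F(l)` through the representatives `x̃ ∈ [0, q)`. [folklore] -/
private theorem sum_zmod_val_eq_sum_range_x {M : Type*} [AddCommMonoid M] {q : ℕ} [NeZero q] (F : ℕ → M) :
    ∑ x : ZMod q, F x.val = ∑ l ∈ range q, F l := by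
  refine Finset.sum_nbij ZMod.val (fun x _ ↦ mem_range.2 (ZMod.val_lt x)) ?_ ?_ (fun _ _ ↦ rfl)
  · exact fun x _ y _ h ↦ ZMod.val_injective q h
  · intro n hn
    exact ⟨(n : ZMod q), by simp, ZMod.val_cast_of_lt (mem_range.1 hn)⟩

/-- The tree's `e^{±2πi·l·p/q}` of (3.8) as `e(t)`, `e(−t)` whenever `lp ≡ t (mod q)`. [folklore] -/
private theorem exp_natCast_mul_eq_x {q : ℕ} (hq : q ≠ 0) {l : ℕ} {p t : ℤ} (h : (l : ZMod q) * (p : ZMod q) = (t : ZMod q)) :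
    cexp (2 * π * I * l * p / q) = cexp (2 * π * I * t / q) ∧
      cexp (-(2 * π * I * l * p / q)) = cexp (2 * π * I * ((-t : ℤ) : ℂ) / q) := by
  have h' : (((l : ℤ) * p : ℤ) : ZMod q) = (t : ZMod q) := by
    rw [Int.cast_mul, Int.cast_natCast, h]
  refine ⟨?_, ?_⟩
  · rw [exp_natCast_mul_intCast_x]
    exact exp_intCast_congr_x hq h'
  · rw [exp_neg_natCast_mul_intCast_x]
    exact exp_intCast_congr_x hq (by rw [Int.cast_neg, Int.cast_neg, h'])

/-- `e^{2πi·l·p/q}·e(−k) = 1 ↔ lp ≡ k` and `e^{−2πi·l·p/q}·e(−k) = 1 ↔ −lp ≡ k (mod q)`: which factors of the `l`-th term vanish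
at `z₀ = e(−k)`. [folklore] -/
private theorem exp_natCast_mul_mul_eq_one_iff_x {q : ℕ} (hq : q ≠ 0) (l : ℕ) (p k : ℤ) :
    (cexp (2 * π * I * l * p / q) * cexp (2 * π * I * ((-k : ℤ) : ℂ) / q) = 1 ↔
      (l : ZMod q) * (p : ZMod q) = (k : ZMod q)) ∧
    (cexp (-(2 * π * I * l * p / q)) * cexp (2 * π * I * ((-k : ℤ) : ℂ) / q) = 1 ↔
      -((l : ZMod q) * (p : ZMod q)) = (k : ZMod q)) := by
  refine ⟨?_, ?_⟩
  · rw [exp_natCast_mul_intCast_x, exp_intCast_mul_exp_intCast_x, exp_intCast_eq_one_iff_cast_x hq]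
    push_cast
    rw [← sub_eq_add_neg, sub_eq_zero]
  · rw [exp_neg_natCast_mul_intCast_x, exp_intCast_mul_exp_intCast_x, exp_intCast_eq_one_iff_cast_x hq]
    push_cast
    rw [← sub_eq_add_neg, sub_eq_zero]

/-- `𝓝[ball 0 1] z₀ ≤ 𝓝[≠] z₀` and `𝓝[ball 0 1] z₀` is nontrivial, for `|z₀| = 1`. [folklore] -/
private theorem nhdsWithin_ball_le_and_neBot_x {z₀ : ℂ} (hz₀ : ‖z₀‖ = 1) :
    𝓝[Metric.ball (0 : ℂ) 1] z₀ ≤ 𝓝[≠] z₀ ∧ (𝓝[Metric.ball (0 : ℂ) 1] z₀).NeBot := by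
  refine ⟨nhdsWithin_mono _ fun z hz (h1 : z = z₀) ↦ ?_, mem_closure_iff_nhdsWithin_neBot.mp ?_⟩
  · rw [h1, mem_ball_zero_iff, hz₀] at hz
    exact lt_irrefl _ hz
  · rw [closure_ball (0 : ℂ) one_ne_zero, Metric.mem_closedBall, dist_zero_right, hz₀]
/-! ### §2 The terms of (3.8) for weights `(s₁, s₂)` at `z₀ = e(−k)`: one vanishing factor from the first pair -/

/-- **Exactly the factor `1 − e(k)z` vanishes**: for `q ∤ 2k`, `q ∤ a − k`, `q ∤ a + k`,
`(1 − e(k)z)·(1 − z²)/((1 − e(k)z)(1 − e(−k)z)(1 − e(a)z)(1 − e(−a)z)) → 1/((1 − e(a − k))(1 − e(−(a + k))))` as `z → e(−k)`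
(the general form of the computation in the proof of [IkedaYamamoto1979] Proposition 4.6, there with `a = kp`).
[cite: BariHunsicker2019, proof of Proposition 3.2 (the limit (limit1))] [cite: IkedaYamamoto1979, proof of Proposition 4.6] -/
private theorem tendsto_core_x {q : ℕ} (hq : q ≠ 0) {k a : ℤ} (h2 : ¬ (q : ℤ) ∣ 2 * k) (ha : ¬ (q : ℤ) ∣ a - k)
    (hb : ¬ (q : ℤ) ∣ a + k) :
    Tendsto (fun z : ℂ ↦ (1 - cexp (2 * π * I * k / q) * z) * ((1 - z ^ 2) /
      ((1 - cexp (2 * π * I * k / q) * z) * (1 - cexp (2 * π * I * ((-k : ℤ) : ℂ) / q) * z) *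
        ((1 - cexp (2 * π * I * a / q) * z) * (1 - cexp (2 * π * I * ((-a : ℤ) : ℂ) / q) * z)))))
      (𝓝[≠] (cexp (2 * π * I * ((-k : ℤ) : ℂ) / q)))
      (𝓝 (1 / ((1 - cexp (2 * π * I * ((a - k : ℤ) : ℂ) / q)) *
        (1 - cexp (2 * π * I * ((-(a + k) : ℤ) : ℂ) / q))))) := by
  -- the values at `z₀ = e(−k)`
  have hγ : cexp (2 * π * I * k / q) * cexp (2 * π * I * ((-k : ℤ) : ℂ) / q) = 1 := by
    rw [exp_intCast_mul_exp_intCast_x, show k + -k = 0 by ring, Int.cast_zero, mul_zero, zero_div, Complex.exp_zero]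
  have hsq : cexp (2 * π * I * ((-k : ℤ) : ℂ) / q) ^ 2 = cexp (2 * π * I * ((-(2 * k) : ℤ) : ℂ) / q) := by
    rw [sq, exp_intCast_mul_exp_intCast_x, show -k + -k = -(2 * k) by ring]
  have hv1 : cexp (2 * π * I * ((-k : ℤ) : ℂ) / q) * cexp (2 * π * I * ((-k : ℤ) : ℂ) / q) =
      cexp (2 * π * I * ((-(2 * k) : ℤ) : ℂ) / q) := by rw [← sq, hsq]
  have hv2 : cexp (2 * π * I * a / q) * cexp (2 * π * I * ((-k : ℤ) : ℂ) / q) =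
      cexp (2 * π * I * ((a - k : ℤ) : ℂ) / q) := by
    rw [exp_intCast_mul_exp_intCast_x, show a + -k = a - k by ring]
  have hv3 : cexp (2 * π * I * ((-a : ℤ) : ℂ) / q) * cexp (2 * π * I * ((-k : ℤ) : ℂ) / q) =
      cexp (2 * π * I * ((-(a + k) : ℤ) : ℂ) / q) := by
    rw [exp_intCast_mul_exp_intCast_x, show -a + -k = -(a + k) by ring]
  have hn1 : 1 - cexp (2 * π * I * ((-(2 * k) : ℤ) : ℂ) / q) ≠ 0 := by
    rw [sub_ne_zero, ne_comm, Ne, exp_intCast_eq_one_iff_x hq, dvd_neg]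
    exact h2
  have hn2 : 1 - cexp (2 * π * I * ((a - k : ℤ) : ℂ) / q) ≠ 0 := by
    rw [sub_ne_zero, ne_comm, Ne, exp_intCast_eq_one_iff_x hq]
    exact ha
  have hn3 : 1 - cexp (2 * π * I * ((-(a + k) : ℤ) : ℂ) / q) ≠ 0 := by
    rw [sub_ne_zero, ne_comm, Ne, exp_intCast_eq_one_iff_x hq, dvd_neg]
    exact hb
  have h := tendsto_mul_div_of_factor_x hγ
    (D := fun z ↦ (1 - cexp (2 * π * I * k / q) * z) * (1 - cexp (2 * π * I * ((-k : ℤ) : ℂ) / q) * z) *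
      ((1 - cexp (2 * π * I * a / q) * z) * (1 - cexp (2 * π * I * ((-a : ℤ) : ℂ) / q) * z)))
    (R := fun z ↦ (1 - cexp (2 * π * I * ((-k : ℤ) : ℂ) / q) * z) *
      ((1 - cexp (2 * π * I * a / q) * z) * (1 - cexp (2 * π * I * ((-a : ℤ) : ℂ) / q) * z)))
    (fun z ↦ by ring) (by fun_prop) (by
      show (1 - cexp (2 * π * I * ((-k : ℤ) : ℂ) / q) * cexp (2 * π * I * ((-k : ℤ) : ℂ) / q)) *
        ((1 - cexp (2 * π * I * a / q) * cexp (2 * π * I * ((-k : ℤ) : ℂ) / q)) *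
          (1 - cexp (2 * π * I * ((-a : ℤ) : ℂ) / q) * cexp (2 * π * I * ((-k : ℤ) : ℂ) / q))) ≠ 0
      rw [hv1, hv2, hv3]
      exact mul_ne_zero hn1 (mul_ne_zero hn2 hn3))
  have hval : (1 - cexp (2 * π * I * ((-k : ℤ) : ℂ) / q) ^ 2) /
      ((1 - cexp (2 * π * I * ((-k : ℤ) : ℂ) / q) * cexp (2 * π * I * ((-k : ℤ) : ℂ) / q)) *
        ((1 - cexp (2 * π * I * a / q) * cexp (2 * π * I * ((-k : ℤ) : ℂ) / q)) *
          (1 - cexp (2 * π * I * ((-a : ℤ) : ℂ) / q) * cexp (2 * π * I * ((-k : ℤ) : ℂ) / q)))) =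
      1 / ((1 - cexp (2 * π * I * ((a - k : ℤ) : ℂ) / q)) *
        (1 - cexp (2 * π * I * ((-(a + k) : ℤ) : ℂ) / q))) := by
    rw [hsq, hv1, hv2, hv3]
    field_simp
  rw [hval] at h
  exact h

/-- **Case `ls₁ ≡ k`**: the term of (3.8) is the function of `tendsto_core_x` with `a = ls₂`; limit
`R(ls₂) = 1/((1 − e(ls₂ − k))(1 − e(−(ls₂ + k))))`. [cite: BariHunsicker2019, proof of Proposition 3.2] -/
private theorem tendsto_term_pos_x {q : ℕ} (hq : q ≠ 0) {k s₁ s₂ : ℤ} (h2 : ¬ (q : ℤ) ∣ 2 * k) {l : ℕ}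
    (hl : (l : ZMod q) * (s₁ : ZMod q) = (k : ZMod q)) (ha : ¬ (q : ℤ) ∣ l * s₂ - k) (hb : ¬ (q : ℤ) ∣ l * s₂ + k) :
    Tendsto (fun z : ℂ ↦ (1 - cexp (2 * π * I * k / q) * z) * ((1 - z ^ 2) /
      ((1 - cexp (2 * π * I * l * (s₁ : ℂ) / q) * z) * (1 - cexp (-(2 * π * I * l * (s₁ : ℂ) / q)) * z) *
        ((1 - cexp (2 * π * I * l * (s₂ : ℂ) / q) * z) * (1 - cexp (-(2 * π * I * l * (s₂ : ℂ) / q)) * z)))))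
      (𝓝[≠] (cexp (2 * π * I * ((-k : ℤ) : ℂ) / q)))
      (𝓝 (1 / ((1 - cexp (2 * π * I * (((l : ℤ) * s₂ - k : ℤ) : ℂ) / q)) *
        (1 - cexp (2 * π * I * ((-((l : ℤ) * s₂ + k) : ℤ) : ℂ) / q))))) := by
  have h3 : (l : ZMod q) * (s₂ : ZMod q) = (((l : ℤ) * s₂ : ℤ) : ZMod q) := by push_cast; ring
  obtain ⟨e1, e2⟩ := exp_natCast_mul_eq_x hq hl
  obtain ⟨e3, e4⟩ := exp_natCast_mul_eq_x hq h3
  simp only [e1, e2, e3, e4]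
  exact tendsto_core_x hq h2 ha hb

/-- **Case `ls₁ ≡ −k`**: the same function of `z` (the first pair is `e(∓k)`); limit `R(ls₂)`.
[cite: BariHunsicker2019, proof of Proposition 3.2] -/
private theorem tendsto_term_neg_x {q : ℕ} (hq : q ≠ 0) {k s₁ s₂ : ℤ} (h2 : ¬ (q : ℤ) ∣ 2 * k) {l : ℕ}
    (hl : (l : ZMod q) * (s₁ : ZMod q) = -(k : ZMod q)) (ha : ¬ (q : ℤ) ∣ l * s₂ - k) (hb : ¬ (q : ℤ) ∣ l * s₂ + k) :
    Tendsto (fun z : ℂ ↦ (1 - cexp (2 * π * I * k / q) * z) * ((1 - z ^ 2) /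
      ((1 - cexp (2 * π * I * l * (s₁ : ℂ) / q) * z) * (1 - cexp (-(2 * π * I * l * (s₁ : ℂ) / q)) * z) *
        ((1 - cexp (2 * π * I * l * (s₂ : ℂ) / q) * z) * (1 - cexp (-(2 * π * I * l * (s₂ : ℂ) / q)) * z)))))
      (𝓝[≠] (cexp (2 * π * I * ((-k : ℤ) : ℂ) / q)))
      (𝓝 (1 / ((1 - cexp (2 * π * I * (((l : ℤ) * s₂ - k : ℤ) : ℂ) / q)) *
        (1 - cexp (2 * π * I * ((-((l : ℤ) * s₂ + k) : ℤ) : ℂ) / q))))) := by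
  have h1 : (l : ZMod q) * (s₁ : ZMod q) = ((-k : ℤ) : ZMod q) := by rw [hl]; push_cast; ring
  have h3 : (l : ZMod q) * (s₂ : ZMod q) = (((l : ℤ) * s₂ : ℤ) : ZMod q) := by push_cast; ring
  obtain ⟨e1, e2⟩ := exp_natCast_mul_eq_x hq h1
  obtain ⟨e3, e4⟩ := exp_natCast_mul_eq_x hq h3
  simp only [e1, e2, e3, e4, neg_neg]
  refine ((tendsto_core_x hq h2 ha hb).congr fun z ↦ ?_)
  ring

/-- **No factor vanishes**: if `ls₁ ≢ ±k` and `ls₂ ≢ ±k` the term times `1 − e(k)z` tends to `0`.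
[cite: BariHunsicker2019, proof of Theorem 3.1 (Case 3: "Each term of the sum vanishes unless …")] -/
private theorem tendsto_term_zero_x {q : ℕ} (hq : q ≠ 0) {k s₁ s₂ : ℤ} {l : ℕ}
    (hA : (l : ZMod q) * (s₁ : ZMod q) ≠ (k : ZMod q)) (hB : -((l : ZMod q) * (s₁ : ZMod q)) ≠ (k : ZMod q))
    (hC : (l : ZMod q) * (s₂ : ZMod q) ≠ (k : ZMod q)) (hD : -((l : ZMod q) * (s₂ : ZMod q)) ≠ (k : ZMod q)) :
    Tendsto (fun z : ℂ ↦ (1 - cexp (2 * π * I * k / q) * z) * ((1 - z ^ 2) /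
      ((1 - cexp (2 * π * I * l * (s₁ : ℂ) / q) * z) * (1 - cexp (-(2 * π * I * l * (s₁ : ℂ) / q)) * z) *
        ((1 - cexp (2 * π * I * l * (s₂ : ℂ) / q) * z) * (1 - cexp (-(2 * π * I * l * (s₂ : ℂ) / q)) * z)))))
      (𝓝[≠] (cexp (2 * π * I * ((-k : ℤ) : ℂ) / q))) (𝓝 0) := by
  have hγ : cexp (2 * π * I * k / q) * cexp (2 * π * I * ((-k : ℤ) : ℂ) / q) = 1 := by
    rw [exp_intCast_mul_exp_intCast_x, show k + -k = 0 by ring, Int.cast_zero, mul_zero, zero_div, Complex.exp_zero]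
  obtain ⟨i1, i2⟩ := exp_natCast_mul_mul_eq_one_iff_x hq l s₁ k
  obtain ⟨i3, i4⟩ := exp_natCast_mul_mul_eq_one_iff_x hq l s₂ k
  have f1 : 1 - cexp (2 * π * I * l * (s₁ : ℂ) / q) * cexp (2 * π * I * ((-k : ℤ) : ℂ) / q) ≠ 0 := by
    rw [sub_ne_zero, ne_comm, Ne, i1]
    exact hA
  have f2 : 1 - cexp (-(2 * π * I * l * (s₁ : ℂ) / q)) * cexp (2 * π * I * ((-k : ℤ) : ℂ) / q) ≠ 0 := by
    rw [sub_ne_zero, ne_comm, Ne, i2]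
    exact hB
  have f3 : 1 - cexp (2 * π * I * l * (s₂ : ℂ) / q) * cexp (2 * π * I * ((-k : ℤ) : ℂ) / q) ≠ 0 := by
    rw [sub_ne_zero, ne_comm, Ne, i3]
    exact hC
  have f4 : 1 - cexp (-(2 * π * I * l * (s₂ : ℂ) / q)) * cexp (2 * π * I * ((-k : ℤ) : ℂ) / q) ≠ 0 := by
    rw [sub_ne_zero, ne_comm, Ne, i4]
    exact hD
  exact tendsto_mul_div_of_ne_zero_x hγ (by fun_prop) (mul_ne_zero (mul_ne_zero f1 f2) (mul_ne_zero f3 f4))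

/-- `q ∣ ls − k ↔ ls ≡ k` and `q ∣ ls + k ↔ −ls ≡ k` in `ℤ/q`. [folklore] -/
private theorem dvd_iff_cast_x (q : ℕ) (l : ℕ) (s k : ℤ) :
    ((q : ℤ) ∣ l * s - k ↔ (l : ZMod q) * (s : ZMod q) = (k : ZMod q)) ∧
      ((q : ℤ) ∣ l * s + k ↔ -((l : ZMod q) * (s : ZMod q)) = (k : ZMod q)) := by
  refine ⟨?_, ?_⟩
  · rw [← ZMod.intCast_zmod_eq_zero_iff_dvd]
    push_cast
    rw [sub_eq_zero]
  · rw [← ZMod.intCast_zmod_eq_zero_iff_dvd]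
    push_cast
    constructor
    · intro h
      linear_combination -h
    · intro h
      linear_combination -h

/-- **The `l`-th term of (3.8) for `L(q; s₁, s₂)` times `1 − e(k)z` at `e(−k)`** when NO `l'` has `l's₂ ≡ ±k` and `q ∤ 2k`:
limit `R(ls₂)` if `ls₁ ≡ ±k`, else `0`. [cite: BariHunsicker2019, proof of Proposition 3.2 ("the terms in the above sum are
non-zero iff one of the following congruences has a solution: (1″) … (4″)")] -/
private theorem tendsto_term_x {q : ℕ} (hq : q ≠ 0) {k s₁ s₂ : ℤ} (h2 : ¬ (q : ℤ) ∣ 2 * k)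
    (hs₂ : ∀ l : ℤ, ¬ (q : ℤ) ∣ l * s₂ - k) (l : ℕ) :
    Tendsto (fun z : ℂ ↦ (1 - cexp (2 * π * I * k / q) * z) * ((1 - z ^ 2) /
      ((1 - cexp (2 * π * I * l * (s₁ : ℂ) / q) * z) * (1 - cexp (-(2 * π * I * l * (s₁ : ℂ) / q)) * z) *
        ((1 - cexp (2 * π * I * l * (s₂ : ℂ) / q) * z) * (1 - cexp (-(2 * π * I * l * (s₂ : ℂ) / q)) * z)))))
      (𝓝[≠] (cexp (2 * π * I * ((-k : ℤ) : ℂ) / q)))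
      (𝓝 (if (l : ZMod q) * (s₁ : ZMod q) = (k : ZMod q) ∨ (l : ZMod q) * (s₁ : ZMod q) = -(k : ZMod q) then
          1 / ((1 - cexp (2 * π * I * (((l : ℤ) * s₂ - k : ℤ) : ℂ) / q)) *
            (1 - cexp (2 * π * I * ((-((l : ℤ) * s₂ + k) : ℤ) : ℂ) / q)))
        else 0)) := by
  have ha : ¬ (q : ℤ) ∣ l * s₂ - k := hs₂ l
  have hb : ¬ (q : ℤ) ∣ l * s₂ + k := fun h ↦ hs₂ (-(l : ℤ)) (by rw [show -(l : ℤ) * s₂ - k = -(l * s₂ + k) by ring, dvd_neg]; exact h)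
  by_cases hA : (l : ZMod q) * (s₁ : ZMod q) = (k : ZMod q)
  · rw [if_pos (Or.inl hA)]
    exact tendsto_term_pos_x hq h2 hA ha hb
  by_cases hB : (l : ZMod q) * (s₁ : ZMod q) = -(k : ZMod q)
  · rw [if_pos (Or.inr hB)]
    exact tendsto_term_neg_x hq h2 hB ha hb
  rw [if_neg (not_or.mpr ⟨hA, hB⟩)]
  obtain ⟨i3, i4⟩ := dvd_iff_cast_x q l s₂ k
  exact tendsto_term_zero_x hq hA (fun h ↦ hB (by rw [← h, neg_neg])) (fun h ↦ ha (i3.mpr h))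
    (fun h ↦ hb (i4.mpr h))

/-- **The residue as a sum over `l`**: `(1 − e(k)z)·∑_n dim E_{n(n+2)}(L(q; s₁, s₂)) z^n →
(1/q)∑_{l<q} [ls₁ ≡ ±k]·R(ls₂)` as `z → e(−k)` in the disc, when `q ∤ 2k` and no `l` has `ls₂ ≡ ±k`.
[cite: BariHunsicker2019, proof of Proposition 3.2, Corollary 2.12] -/
theorem tendsto_one_sub_exp_mul_tsum_lensMultiplicity_eq_sum {q : ℕ} [NeZero q] {k s₁ s₂ : ℤ}
    (h2 : ¬ (q : ℤ) ∣ 2 * k) (hs₂ : ∀ l : ℤ, ¬ (q : ℤ) ∣ l * s₂ - k) :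
    Tendsto (fun z : ℂ ↦ (1 - cexp (2 * π * I * k / q) * z) * ∑' n : ℕ, (lensMultiplicity q s₁ s₂ n : ℂ) * z ^ n)
      (𝓝[Metric.ball 0 1] (cexp (2 * π * I * ((-k : ℤ) : ℂ) / q)))
      (𝓝 (1 / (q : ℂ) * ∑ l ∈ range q,
        if (l : ZMod q) * (s₁ : ZMod q) = (k : ZMod q) ∨ (l : ZMod q) * (s₁ : ZMod q) = -(k : ZMod q) then
          1 / ((1 - cexp (2 * π * I * (((l : ℤ) * s₂ - k : ℤ) : ℂ) / q)) *
            (1 - cexp (2 * π * I * ((-((l : ℤ) * s₂ + k) : ℤ) : ℂ) / q)))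
        else 0)) := by
  have hq : q ≠ 0 := NeZero.ne q
  have h := (tendsto_finsetSum (range q) fun l (_ : l ∈ range q) ↦ tendsto_term_x (s₁ := s₁) hq h2 hs₂ l).const_mul (1 / (q : ℂ))
  obtain ⟨hle, _⟩ := nhdsWithin_ball_le_and_neBot_x (norm_exp_intCast_x q (-k))
  refine ((h.mono_left hle).congr' ?_)
  filter_upwards [self_mem_nhdsWithin] with z hz
  rw [tsum_lensMultiplicity_mul_pow q hq s₁ s₂ (mem_ball_zero_iff.mp hz), Finset.mul_sum, Finset.mul_sum, Finset.mul_sum]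
  exact Finset.sum_congr rfl fun l _ ↦ by ring


/-! ### §3 The pole `γ^{−x}` of `L(q; x, w)`, `q = xm`: the contributing terms are `l ≡ ±1 (mod m)` -/

/-- For `q = xm`, `x ≠ 0`, `m ≥ 3`, `r < m`: `(tm + r)x ≡ x (mod q) ↔ r = 1` and `(tm + r)x ≡ −x ↔ r = m − 1` — "the solution to
(1″) is `l = tq_{/x} − 1` and the solution to (2″) is `l = tq_{/x} + 1`". [cite: BariHunsicker2019, proof of Proposition 3.2] -/
private theorem cond_iff_x {x m : ℕ} (hx : x ≠ 0) (hm : 3 ≤ m) (t : ℕ) {r : ℕ} (hr : r < m) :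
    ((((t * m + r : ℕ) : ZMod (x * m)) * (x : ZMod (x * m)) = (x : ZMod (x * m)) ↔ r = 1) ∧
      (((t * m + r : ℕ) : ZMod (x * m)) * (x : ZMod (x * m)) = -(x : ZMod (x * m)) ↔ r = m - 1)) := by
  have hxz : (x : ℤ) ≠ 0 := Nat.cast_ne_zero.mpr hx
  have key : ∀ c : ℤ, ((x * m : ℕ) : ℤ) ∣ c * x ↔ (m : ℤ) ∣ c := fun c ↦ by
    rw [Nat.cast_mul, mul_comm (x : ℤ), mul_dvd_mul_iff_right hxz]
  refine ⟨?_, ?_⟩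
  · rw [show ((t * m + r : ℕ) : ZMod (x * m)) * (x : ZMod (x * m)) = (x : ZMod (x * m)) ↔
        ((((t * m + r : ℕ) : ℤ) * x - x : ℤ) : ZMod (x * m)) = 0 by push_cast; rw [sub_eq_zero],
      ZMod.intCast_zmod_eq_zero_iff_dvd, show (((t * m + r : ℕ) : ℤ) * x - x : ℤ) = ((t : ℤ) * m + r - 1) * x by
        push_cast; ring, key]
    constructor
    · intro h
      have h1 : (m : ℤ) ∣ (r : ℤ) - 1 := by
        have e : (r : ℤ) - 1 = ((t : ℤ) * m + r - 1) - m * t := by ring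
        rw [e]
        exact dvd_sub h (dvd_mul_right _ _)
      have h2 : (r : ℤ) - 1 = 0 := Int.eq_zero_of_abs_lt_dvd h1 (by rw [abs_lt]; constructor <;> omega)
      omega
    · rintro rfl
      exact ⟨t, by push_cast; ring⟩
  · rw [show ((t * m + r : ℕ) : ZMod (x * m)) * (x : ZMod (x * m)) = -(x : ZMod (x * m)) ↔
        ((((t * m + r : ℕ) : ℤ) * x + x : ℤ) : ZMod (x * m)) = 0 by push_cast; rw [← eq_neg_iff_add_eq_zero],
      ZMod.intCast_zmod_eq_zero_iff_dvd, show (((t * m + r : ℕ) : ℤ) * x + x : ℤ) = ((t : ℤ) * m + r + 1) * x by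
        push_cast; ring, key]
    constructor
    · intro h
      have h1 : (m : ℤ) ∣ (r : ℤ) + 1 - m := by
        have e : (r : ℤ) + 1 - m = ((t : ℤ) * m + r + 1) - m * (t + 1) := by ring
        rw [e]
        exact dvd_sub h (dvd_mul_right _ _)
      have h2 : (r : ℤ) + 1 - m = 0 := Int.eq_zero_of_abs_lt_dvd h1 (by rw [abs_lt]; constructor <;> omega)
      omega
    · intro h
      subst h
      exact ⟨t + 1, by push_cast [show 1 ≤ m by omega]; ring⟩

/-- **Summing the limits over `l < q = xm`**: writing `l = tm + r`, only `r = 1` and `r = m − 1` contribute, so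
`∑_{l<q}[lx ≡ ±x]·R(l) = ∑_{t<x}(R(tm + 1) + R(tm + m − 1))`. [cite: BariHunsicker2019, proof of Proposition 3.2 ("for
`t ∈ {1, …, x}`")] -/
private theorem sum_cond_eq_x {x m : ℕ} (hx : x ≠ 0) (hm : 3 ≤ m) (R : ℕ → ℂ) :
    ∑ l ∈ range (x * m), (if (l : ZMod (x * m)) * (x : ZMod (x * m)) = (x : ZMod (x * m)) ∨
        (l : ZMod (x * m)) * (x : ZMod (x * m)) = -(x : ZMod (x * m)) then R l else 0) =
      ∑ t ∈ range x, (R (t * m + 1) + R (t * m + (m - 1))) := by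
  -- split `range (xm)` into blocks of length `m`
  have hsplit : ∀ (f : ℕ → ℂ) (y : ℕ), ∑ l ∈ range (y * m), f l = ∑ t ∈ range y, ∑ r ∈ range m, f (t * m + r) := by
    intro f y
    induction y with
    | zero => simp
    | succ y ih => rw [Nat.succ_mul, Finset.sum_range_add, ih, Finset.sum_range_succ]
  rw [hsplit]
  refine Finset.sum_congr rfl fun t _ ↦ ?_
  have hpt : ∀ r ∈ range m, (if ((t * m + r : ℕ) : ZMod (x * m)) * (x : ZMod (x * m)) = (x : ZMod (x * m)) ∨
      ((t * m + r : ℕ) : ZMod (x * m)) * (x : ZMod (x * m)) = -(x : ZMod (x * m)) then R (t * m + r) else 0) =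
      (if 1 = r then R (t * m + r) else 0) + (if m - 1 = r then R (t * m + r) else 0) := by
    intro r hr
    obtain ⟨c1, c2⟩ := cond_iff_x hx hm t (mem_range.mp hr)
    simp only [c1, c2]
    by_cases h1 : r = 1
    · subst h1
      rw [if_pos (Or.inl rfl), if_pos rfl, if_neg (by omega), add_zero]
    by_cases h2 : r = m - 1
    · subst h2
      rw [if_pos (Or.inr rfl), if_neg (by omega), if_pos rfl, zero_add]
    rw [if_neg (not_or.mpr ⟨h1, h2⟩), if_neg (Ne.symm h1), if_neg (Ne.symm h2), add_zero]
  rw [Finset.sum_congr rfl hpt, Finset.sum_add_distrib, Finset.sum_ite_eq, Finset.sum_ite_eq,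
    if_pos (mem_range.mpr (by omega)), if_pos (mem_range.mpr (by omega))]

/-! ### §4 The residue term `R(l) = 1/((1 − e(lw − x))(1 − e(−(lw + x))))`: symmetry, partial fractions, geometric sums -/

/-- **Symmetry `l ↦ q − l`**: `R(l) = R(l')` when `q ∣ (l + l')w` (the factors swap). [folklore] -/
private theorem R_symm_x {q : ℕ} (hq : q ≠ 0) {x w : ℤ} {l l' : ℤ} (h : (q : ℤ) ∣ (l + l') * w) :
    1 / ((1 - cexp (2 * π * I * ((l * w - x : ℤ) : ℂ) / q)) * (1 - cexp (2 * π * I * ((-(l * w + x) : ℤ) : ℂ) / q))) =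
      1 / ((1 - cexp (2 * π * I * ((l' * w - x : ℤ) : ℂ) / q)) * (1 - cexp (2 * π * I * ((-(l' * w + x) : ℤ) : ℂ) / q))) := by
  have e1 : cexp (2 * π * I * ((l * w - x : ℤ) : ℂ) / q) = cexp (2 * π * I * ((-(l' * w + x) : ℤ) : ℂ) / q) :=
    exp_intCast_congr_x hq ((ZMod.intCast_eq_intCast_iff_dvd_sub _ _ _).mpr
      (by rw [show -(l' * w + x) - (l * w - x) = -((l + l') * w) by ring, dvd_neg]; exact h))
  have e2 : cexp (2 * π * I * ((-(l * w + x) : ℤ) : ℂ) / q) = cexp (2 * π * I * ((l' * w - x : ℤ) : ℂ) / q) :=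
    exp_intCast_congr_x hq ((ZMod.intCast_eq_intCast_iff_dvd_sub _ _ _).mpr
      (by rw [show l' * w - x - -(l * w + x) = (l + l') * w by ring]; exact h))
  rw [e1, e2, mul_comm]

/-- **Partial fractions**: with `P = e(lw − x)`, `Q = e(lw + x)` (`P = Q·e(−2x)`, `e(−(lw + x)) = Q⁻¹`), no factor zero:
`1/((1 − P)(1 − Q⁻¹)) = (1/(1 − e(−2x)))·(1/(1 − P) − 1/(1 − Q))`. [folklore] -/
private theorem partial_fractions_x {P Q U : ℂ} (hPQ : P = Q * U) (hQ : Q ≠ 0) (hP1 : 1 - P ≠ 0) (hQ1 : 1 - Q ≠ 0)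
    (hU1 : 1 - U ≠ 0) : 1 / ((1 - P) * (1 - Q⁻¹)) = 1 / (1 - U) * (1 / (1 - P) - 1 / (1 - Q)) := by
  have hQ1' : Q - 1 ≠ 0 := fun h ↦ hQ1 (by rw [← neg_sub, h, neg_zero])
  rw [hPQ] at hP1 ⊢
  field_simp
  ring

/-- **The geometric sum over the `x`-th roots of unity**: for `E^x ≠ 1` and `c` prime to `x`,
`∑_{t<x} 1/(1 − E·e^{2πitc/x}) = x/(1 − E^x)` (expand `1/(1 − Eω) = ∑_{j<x}(Eω)^j/(1 − E^x)` for `ω^x = 1` and use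
`∑_{t<x} ω_j^t = 0` for `0 < j < x`). [folklore] -/
private theorem geom_sum_inv_x {x : ℕ} (hx : x ≠ 0) {c : ℕ} (hc : Nat.Coprime c x) {E : ℂ} (hE : E ^ x ≠ 1) :
    ∑ t ∈ range x, 1 / (1 - E * cexp (2 * π * I * ((t * c : ℕ) : ℂ) / x)) = x / (1 - E ^ x) := by
  set ω : ℕ → ℂ := fun t ↦ cexp (2 * π * I * ((t * c : ℕ) : ℂ) / x) with hω
  have hxC : (x : ℂ) ≠ 0 := Nat.cast_ne_zero.mpr hx
  have hωpow : ∀ t j : ℕ, ω t ^ j = cexp (2 * π * I * ((t * j * c : ℕ) : ℂ) / x) := fun t j ↦ by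
    rw [hω]
    dsimp only
    rw [← Complex.exp_nat_mul]
    congr 1
    push_cast
    ring
  have hωx : ∀ t, ω t ^ x = 1 := fun t ↦ by
    rw [hωpow, show (2 * π * I * ((t * x * c : ℕ) : ℂ) / x : ℂ) = ((t * c : ℕ) : ℂ) * (2 * π * I) by
      push_cast; field_simp]
    exact Complex.exp_nat_mul_two_pi_mul_I (t * c)
  have hsymm : ∀ t j : ℕ, ω t ^ j = ω j ^ t := fun t j ↦ by rw [hωpow, hωpow, mul_comm t j]
  have h1E : 1 - E ^ x ≠ 0 := sub_ne_zero.mpr (Ne.symm hE)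
  have hden : ∀ t, 1 - E * ω t ≠ 0 := fun t h ↦ hE (by
    have h' : E * ω t = 1 := (sub_eq_zero.mp h).symm
    calc E ^ x = E ^ x * ω t ^ x := by rw [hωx, mul_one]
      _ = (E * ω t) ^ x := (mul_pow _ _ _).symm
      _ = 1 := by rw [h', one_pow])
  have hterm : ∀ t ∈ range x, 1 / (1 - E * ω t) = (∑ j ∈ range x, E ^ j * ω j ^ t) / (1 - E ^ x) := by
    intro t _
    have hg := mul_neg_geom_sum (E * ω t) x
    rw [mul_pow, hωx, mul_one] at hg
    have hG : ∑ j ∈ range x, (E * ω t) ^ j = ∑ j ∈ range x, E ^ j * ω j ^ t :=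
      Finset.sum_congr rfl fun j _ ↦ by rw [mul_pow, hsymm]
    rw [hG] at hg
    rw [div_eq_div_iff (hden t) h1E, one_mul, ← hg]
    ring
  have hω1 : ∀ j ∈ range x, j ≠ 0 → ω j ≠ 1 := by
    intro j hj hj0 h
    rw [hω] at h
    dsimp only at h
    rw [show ((j * c : ℕ) : ℂ) = (((j * c : ℕ) : ℤ) : ℂ) by push_cast; rfl, exp_intCast_eq_one_iff_x hx] at h
    have h2 : x ∣ j * c := by exact_mod_cast h
    have h3 : x ∣ j := hc.symm.dvd_of_dvd_mul_right h2
    have h4 := Nat.eq_zero_of_dvd_of_lt h3 (mem_range.mp hj)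
    exact hj0 h4
  calc ∑ t ∈ range x, 1 / (1 - E * ω t)
      = ∑ t ∈ range x, (∑ j ∈ range x, E ^ j * ω j ^ t) / (1 - E ^ x) := Finset.sum_congr rfl hterm
    _ = (∑ j ∈ range x, E ^ j * ∑ t ∈ range x, ω j ^ t) / (1 - E ^ x) := by
        rw [← Finset.sum_div, Finset.sum_comm]
        simp only [Finset.mul_sum]
    _ = (E ^ 0 * ∑ t ∈ range x, ω 0 ^ t) / (1 - E ^ x) := by
        rw [Finset.sum_eq_single 0 (fun j hj hj0 ↦ ?_) (fun h ↦ absurd (mem_range.mpr (Nat.pos_of_ne_zero hx)) h)]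
        rw [geom_sum_eq (hω1 j hj hj0), hωx, sub_self, zero_div, mul_zero]
    _ = x / (1 - E ^ x) := by
        have h0 : ω 0 = 1 := by rw [hω]; simp
        rw [h0, pow_zero, one_mul]
        simp

/-- A natural representative `c` of `w mod x`, prime to `x` when `w` is. [folklore] -/
private theorem exists_nat_rep_x {x : ℕ} (hx : x ≠ 0) {w : ℤ} (hwx : IsCoprime w x) :
    ∃ c : ℕ, Nat.Coprime c x ∧ (x : ℤ) ∣ w - c := by
  have hx0 : (0 : ℤ) < x := by exact_mod_cast Nat.pos_of_ne_zero hx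
  refine ⟨(w % x).toNat, ?_, ?_⟩
  · have h1 : ((w % x).toNat : ℤ) = w % x := Int.toNat_of_nonneg (Int.emod_nonneg _ hx0.ne')
    have h2 : IsCoprime (w % x) x := by
      rw [Int.emod_def, sub_eq_add_neg, ← mul_neg]
      exact hwx.add_mul_left_left _
    rw [← h1] at h2
    have h3 := Int.isCoprime_iff_gcd_eq_one.mp h2
    rwa [Int.gcd_natCast_natCast] at h3
  · rw [Int.toNat_of_nonneg (Int.emod_nonneg _ hx0.ne'), Int.emod_def, sub_sub_cancel]
    exact dvd_mul_right _ _

/-- **`e((tm + 1)w + a) = e(w + a)·e^{2πitc/x}`** for `q = xm`, `c ≡ w (mod x)`: the progression `l = tm + 1` moves `e(lw + a)`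
around the `x`-th roots of unity. [folklore] -/
private theorem exp_progression_x {x m : ℕ} (hx : x ≠ 0) (hm : m ≠ 0) {w : ℤ} {c : ℕ} (hc : (x : ℤ) ∣ w - c) (a : ℤ)
    (t : ℕ) :
    cexp (2 * π * I * (((((t * m + 1 : ℕ) : ℤ) * w + a : ℤ)) : ℂ) / ((x * m : ℕ) : ℂ)) =
      cexp (2 * π * I * ((w + a : ℤ) : ℂ) / ((x * m : ℕ) : ℂ)) * cexp (2 * π * I * ((t * c : ℕ) : ℂ) / x) := by
  have hq : x * m ≠ 0 := mul_ne_zero hx hm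
  have hmC : (m : ℂ) ≠ 0 := Nat.cast_ne_zero.mpr hm
  have hxC : (x : ℂ) ≠ 0 := Nat.cast_ne_zero.mpr hx
  rw [show cexp (2 * π * I * ((t * c : ℕ) : ℂ) / x) = cexp (2 * π * I * (((t * m * c : ℕ) : ℤ) : ℂ) / ((x * m : ℕ) : ℂ)) by
    congr 1; push_cast; field_simp, exp_intCast_mul_exp_intCast_x]
  refine exp_intCast_congr_x hq ((ZMod.intCast_eq_intCast_iff_dvd_sub _ _ _).mpr ?_)
  obtain ⟨d, hd⟩ := hc
  refine ⟨-(t * d), ?_⟩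
  push_cast
  linear_combination (-(t : ℤ) * m) * hd

/-- **`∑_{t<x} 1/(1 − e((tm + 1)w + a)) = x/(1 − e(x(w + a)))`** for `q = xm`, `w` prime to `x`, `m ∤ w + a`.
[folklore] -/
private theorem sum_inv_progression_x {x m : ℕ} (hx : x ≠ 0) (hm : m ≠ 0) {w : ℤ} (hwx : IsCoprime w x) (a : ℤ)
    (ha : ¬ (m : ℤ) ∣ w + a) :
    ∑ t ∈ range x, 1 / (1 - cexp (2 * π * I * (((((t * m + 1 : ℕ) : ℤ) * w + a : ℤ)) : ℂ) / ((x * m : ℕ) : ℂ))) =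
      x / (1 - cexp (2 * π * I * ((x * (w + a) : ℤ) : ℂ) / ((x * m : ℕ) : ℂ))) := by
  have hq : x * m ≠ 0 := mul_ne_zero hx hm
  obtain ⟨c, hc, hwc⟩ := exists_nat_rep_x hx hwx
  have hEx : cexp (2 * π * I * ((w + a : ℤ) : ℂ) / ((x * m : ℕ) : ℂ)) ^ x =
      cexp (2 * π * I * ((x * (w + a) : ℤ) : ℂ) / ((x * m : ℕ) : ℂ)) := by
    rw [← Complex.exp_nat_mul]
    congr 1
    push_cast
    ring
  have hE : cexp (2 * π * I * ((w + a : ℤ) : ℂ) / ((x * m : ℕ) : ℂ)) ^ x ≠ 1 := by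
    rw [hEx, Ne, exp_intCast_eq_one_iff_x hq, Nat.cast_mul, mul_dvd_mul_iff_left (Nat.cast_ne_zero.mpr hx)]
    exact ha
  simp only [exp_progression_x hx hm hwc a]
  rw [geom_sum_inv_x hx hc hE, hEx]

/-- **The residue sum in closed form**: for `q = xm`, `m ≥ 3`, `w` prime to `x` and `m ∤ w ± x`,
`∑_{t<x} R(tm + 1) = (1/(1 − e(−2x)))·(x/(1 − e(x(w − x))) − x/(1 − e(x(w + x))))`.
[cite: BariHunsicker2019, proof of Proposition 3.2 (the evaluation of (limit1))] -/
private theorem sum_R_eq_x {x m : ℕ} (hx : x ≠ 0) (hm : 3 ≤ m) {w : ℤ} (hwx : IsCoprime w x)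
    (hm₁ : ¬ (m : ℤ) ∣ w - x) (hp₁ : ¬ (m : ℤ) ∣ w + x) :
    ∑ t ∈ range x, 1 / ((1 - cexp (2 * π * I * (((((t * m + 1 : ℕ) : ℤ) * w - x : ℤ)) : ℂ) / ((x * m : ℕ) : ℂ))) *
        (1 - cexp (2 * π * I * ((-((((t * m + 1 : ℕ) : ℤ)) * w + x) : ℤ) : ℂ) / ((x * m : ℕ) : ℂ)))) =
      1 / (1 - cexp (2 * π * I * ((-(2 * x) : ℤ) : ℂ) / ((x * m : ℕ) : ℂ))) *
        (x / (1 - cexp (2 * π * I * ((x * (w - x) : ℤ) : ℂ) / ((x * m : ℕ) : ℂ))) -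
          x / (1 - cexp (2 * π * I * ((x * (w + x) : ℤ) : ℂ) / ((x * m : ℕ) : ℂ)))) := by
  have hm0 : m ≠ 0 := by omega
  have hq : x * m ≠ 0 := mul_ne_zero hx hm0
  -- no factor vanishes
  have hU1 : 1 - cexp (2 * π * I * ((-(2 * x) : ℤ) : ℂ) / ((x * m : ℕ) : ℂ)) ≠ 0 := by
    rw [sub_ne_zero, ne_comm, Ne, exp_intCast_eq_one_iff_x hq, dvd_neg, Nat.cast_mul, mul_comm (2 : ℤ),
      mul_dvd_mul_iff_left (Nat.cast_ne_zero.mpr hx)]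
    intro h
    have := Int.le_of_dvd two_pos h
    omega
  have hP1 : ∀ t : ℕ, 1 - cexp (2 * π * I * (((((t * m + 1 : ℕ) : ℤ) * w - x : ℤ)) : ℂ) / ((x * m : ℕ) : ℂ)) ≠ 0 := by
    intro t h
    rw [sub_eq_zero, eq_comm, exp_intCast_eq_one_iff_x hq] at h
    apply hm₁
    have h1 : (m : ℤ) ∣ (((t * m + 1 : ℕ) : ℤ) * w - x) := (Dvd.intro_left _ (by rw [Nat.cast_mul])).trans h
    have e : w - x = (((t * m + 1 : ℕ) : ℤ) * w - x) - m * (t * w) := by push_cast; ring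
    rw [e]
    exact dvd_sub h1 (dvd_mul_right _ _)
  have hQ1 : ∀ t : ℕ, 1 - cexp (2 * π * I * (((((t * m + 1 : ℕ) : ℤ) * w + x : ℤ)) : ℂ) / ((x * m : ℕ) : ℂ)) ≠ 0 := by
    intro t h
    rw [sub_eq_zero, eq_comm, exp_intCast_eq_one_iff_x hq] at h
    apply hp₁
    have h1 : (m : ℤ) ∣ (((t * m + 1 : ℕ) : ℤ) * w + x) := (Dvd.intro_left _ (by rw [Nat.cast_mul])).trans h
    have e : w + x = (((t * m + 1 : ℕ) : ℤ) * w + x) - m * (t * w) := by push_cast; ring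
    rw [e]
    exact dvd_sub h1 (dvd_mul_right _ _)
  -- partial fractions termwise
  have hpf : ∀ t ∈ range x,
      1 / ((1 - cexp (2 * π * I * (((((t * m + 1 : ℕ) : ℤ) * w - x : ℤ)) : ℂ) / ((x * m : ℕ) : ℂ))) *
        (1 - cexp (2 * π * I * ((-((((t * m + 1 : ℕ) : ℤ)) * w + x) : ℤ) : ℂ) / ((x * m : ℕ) : ℂ)))) =
      1 / (1 - cexp (2 * π * I * ((-(2 * x) : ℤ) : ℂ) / ((x * m : ℕ) : ℂ))) *
        (1 / (1 - cexp (2 * π * I * (((((t * m + 1 : ℕ) : ℤ) * w - x : ℤ)) : ℂ) / ((x * m : ℕ) : ℂ))) -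
          1 / (1 - cexp (2 * π * I * (((((t * m + 1 : ℕ) : ℤ) * w + x : ℤ)) : ℂ) / ((x * m : ℕ) : ℂ)))) := by
    intro t _
    have hinv : cexp (2 * π * I * ((-((((t * m + 1 : ℕ) : ℤ)) * w + x) : ℤ) : ℂ) / ((x * m : ℕ) : ℂ)) =
        (cexp (2 * π * I * (((((t * m + 1 : ℕ) : ℤ) * w + x : ℤ)) : ℂ) / ((x * m : ℕ) : ℂ)))⁻¹ := by
      rw [← Complex.exp_neg]
      congr 1
      push_cast
      ring
    rw [hinv]
    refine partial_fractions_x ?_ (Complex.exp_ne_zero _) (hP1 t) (hQ1 t) hU1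
    rw [exp_intCast_mul_exp_intCast_x]
    congr 3
    ring
  have hsub := sum_inv_progression_x hx hm0 hwx (-(x : ℤ)) (by rwa [← sub_eq_add_neg])
  simp only [← sub_eq_add_neg] at hsub
  rw [Finset.sum_congr rfl hpf, ← Finset.mul_sum, Finset.sum_sub_distrib, hsub,
    sum_inv_progression_x hx hm0 hwx (x : ℤ) hp₁]


/-! ### §5 The residue of the generating function of `L(q; x, w)` at `γ^{−x}` in closed form; Proposition 3.2 -/

/-- `tm + (m − 1) + ((x − 1 − t)m + 1) = xm` for `t < x`, `m ≥ 1`: the reflection pairing the classes `l ≡ −1` and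
`l ≡ 1 (mod m)`. [folklore] -/
private theorem index_add_x {x m t : ℕ} (ht : t < x) (hm : 1 ≤ m) : t * m + (m - 1) + ((x - 1 - t) * m + 1) = x * m := by
  obtain ⟨m', rfl⟩ : ∃ m', m = m' + 1 := ⟨m - 1, by omega⟩
  obtain ⟨s, rfl⟩ : ∃ s, x = t + s + 1 := ⟨x - t - 1, by omega⟩
  rw [show t + s + 1 - 1 - t = s by omega, show m' + 1 - 1 = m' by omega]
  ring

/-- **THE RESIDUE OF THE GENERATING FUNCTION OF THE ORBIFOLD LENS SPACE `L(q; x, w)` AT `γ^{−x}`, IN CLOSED FORM**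
(Bari–Hunsicker, proof of Proposition 3.2, for `L = L(q : x, py)`; here `q = xm` with `m ≥ 3`, `w` prime to `x`, and
`m ∤ lw − x` for all `l` — in the source `x = gcd(x, q)`, `y = gcd(py, q) ∤ x`): as `z → e(−x) = γ^{−x}` in the unit disc,
`(1 − e(x)z)·∑_n dim E_{n(n+2)} z^n → (2/q)·(1/(1 − e(−2x)))·(x/(1 − e(x(w − x))) − x/(1 − e(x(w + x))))`.
The source's computation: only the terms `l ≡ ±1 (mod q/x)` of (3.8) contribute ("(3″) has no solution. Similarly (4″) …
The solution to (1″) is `l = tq_{/x} − 1` and the solution to (2″) is `l = tq_{/x} + 1` for `t ∈ {1, …, x}`"), each with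
the limit `1/((1 − γ^{…})(1 − γ^{…}))`, giving `(2/q)∑_{t=1}^{x} 1/((1 − e(py(tq_{/x} − 1) + x))(1 − e(−py(tq_{/x} − 1) + x)))`
(the display (limit1) and the line after it, up to the factor `−γ^x` between `z − γ^x` and `1 − γ^{−x}z`, and conjugation
`γ ↦ γ^{−1}`); the closed form of this sum (partial fractions in `e(±x)` and the geometric sum over the `x`-th roots of unity
`e(tq_{/x}w)`) replaces the source's cotangent expression (eq:cot). [cite: BariHunsicker2019, Proposition 3.2 (proof:
(limit1) and the following display), Corollary 2.12] -/
theorem tendsto_one_sub_exp_mul_tsum_lensMultiplicity_axis {q x m : ℕ} [NeZero q] (hq : q = x * m) (hm : 3 ≤ m)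
    {w : ℤ} (hwx : IsCoprime w x) (hw : ∀ l : ℤ, ¬ (m : ℤ) ∣ l * w - x) :
    Tendsto (fun z : ℂ ↦ (1 - cexp (2 * π * I * ((x : ℤ) : ℂ) / q) * z) *
        ∑' n : ℕ, (lensMultiplicity q x w n : ℂ) * z ^ n)
      (𝓝[Metric.ball 0 1] (cexp (2 * π * I * ((-(x : ℤ) : ℤ) : ℂ) / q)))
      (𝓝 (2 / (q : ℂ) * (1 / (1 - cexp (2 * π * I * ((-(2 * x) : ℤ) : ℂ) / q)) *
        (x / (1 - cexp (2 * π * I * ((x * (w - x) : ℤ) : ℂ) / q)) -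
          x / (1 - cexp (2 * π * I * ((x * (w + x) : ℤ) : ℂ) / q)))))) := by
  have hq0 : q ≠ 0 := NeZero.ne q
  subst hq
  have hx : x ≠ 0 := fun h ↦ hq0 (by rw [h, zero_mul])
  have hm0 : m ≠ 0 := by omega
  have h2 : ¬ ((x * m : ℕ) : ℤ) ∣ 2 * (x : ℤ) := by
    rw [Nat.cast_mul, mul_comm (2 : ℤ), mul_dvd_mul_iff_left (Nat.cast_ne_zero.mpr hx)]
    intro h
    have := Int.le_of_dvd two_pos h
    omega
  have hs₂ : ∀ l : ℤ, ¬ ((x * m : ℕ) : ℤ) ∣ l * w - x := fun l h ↦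
    hw l ((Dvd.intro_left _ (by rw [Nat.cast_mul])).trans h)
  have hm₁ : ¬ (m : ℤ) ∣ w - x := by simpa using hw 1
  have hp₁ : ¬ (m : ℤ) ∣ w + x := fun h' ↦
    hw (-1) (by rw [show (-1 : ℤ) * w - x = -(w + x) by ring, dvd_neg]; exact h')
  have h := tendsto_one_sub_exp_mul_tsum_lensMultiplicity_eq_sum (s₁ := (x : ℤ)) h2 hs₂
  simp only [Int.cast_natCast] at h
  -- the sum over `l < q`: the classes `l ≡ 1` and `l ≡ −1 (mod m)`
  have hS := sum_cond_eq_x hx hm (fun l : ℕ ↦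
    1 / ((1 - cexp (2 * π * I * ((((l : ℤ) * w - x : ℤ)) : ℂ) / ((x * m : ℕ) : ℂ))) *
      (1 - cexp (2 * π * I * ((-((l : ℤ) * w + x) : ℤ) : ℂ) / ((x * m : ℕ) : ℂ)))))
  beta_reduce at hS
  -- the class `l ≡ −1` gives the same sum as the class `l ≡ 1`
  have hrefl : ∑ t ∈ range x, 1 / ((1 - cexp (2 * π * I * (((((t * m + (m - 1) : ℕ) : ℤ)) * w - x : ℤ) : ℂ) /
        ((x * m : ℕ) : ℂ))) * (1 - cexp (2 * π * I * ((-((((t * m + (m - 1) : ℕ) : ℤ)) * w + x) : ℤ) : ℂ) /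
          ((x * m : ℕ) : ℂ)))) =
      ∑ t ∈ range x, 1 / ((1 - cexp (2 * π * I * (((((t * m + 1 : ℕ) : ℤ)) * w - x : ℤ) : ℂ) / ((x * m : ℕ) : ℂ))) *
        (1 - cexp (2 * π * I * ((-((((t * m + 1 : ℕ) : ℤ)) * w + x) : ℤ) : ℂ) / ((x * m : ℕ) : ℂ)))) := by
    rw [← Finset.sum_range_reflect (fun t ↦ 1 / ((1 - cexp (2 * π * I * (((((t * m + 1 : ℕ) : ℤ)) * w - x : ℤ) : ℂ) /
      ((x * m : ℕ) : ℂ))) * (1 - cexp (2 * π * I * ((-((((t * m + 1 : ℕ) : ℤ)) * w + x) : ℤ) : ℂ) / ((x * m : ℕ) : ℂ))))) x]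
    refine Finset.sum_congr rfl fun t ht ↦ R_symm_x (mul_ne_zero hx hm0) ⟨w, ?_⟩
    have e : (((t * m + (m - 1) : ℕ) : ℤ)) + (((x - 1 - t) * m + 1 : ℕ) : ℤ) = ((x * m : ℕ) : ℤ) := by
      exact_mod_cast index_add_x (mem_range.mp ht) (by omega)
    rw [e]
  rw [Finset.sum_add_distrib, hrefl, ← two_mul, sum_R_eq_x hx hm hwx hm₁ hp₁] at hS
  rw [hS] at h
  simp only [Int.cast_natCast]
  convert h using 2
  ring

/-- **PROPOSITION 3.2 (Bari–Hunsicker 2019).** "Suppose `L = L(q : x, py)` is an orbifold lens space with spectrum generating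
function `F_q(z)`. Then `lim_{z→γ^x}(z − γ^x)F_q(z) ≠ 0`." In the closed form of
`tendsto_one_sub_exp_mul_tsum_lensMultiplicity_axis`: for `q = xm`, `m ≥ 3`, `m ∤ 2x` (in the source: `y ∤ 2x`, "(iii)
… this means that `y | 2x`, which is not possible"), and `m ∤ w ± x`, the residue
`(2/q)(1/(1 − e(−2x)))(x/(1 − e(x(w − x))) − x/(1 − e(x(w + x))))` is nonzero, since `e(x(w − x)) ≠ e(x(w + x))`.
[cite: BariHunsicker2019, Proposition 3.2] -/
theorem residue_axis_ne_zero {q x m : ℕ} [NeZero q] (hq : q = x * m) (hm : 3 ≤ m) (h2x : ¬ (m : ℤ) ∣ 2 * x) {w : ℤ}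
    (hm₁ : ¬ (m : ℤ) ∣ w - x) (hp₁ : ¬ (m : ℤ) ∣ w + x) :
    2 / (q : ℂ) * (1 / (1 - cexp (2 * π * I * ((-(2 * x) : ℤ) : ℂ) / q)) *
        (x / (1 - cexp (2 * π * I * ((x * (w - x) : ℤ) : ℂ) / q)) -
          x / (1 - cexp (2 * π * I * ((x * (w + x) : ℤ) : ℂ) / q)))) ≠ 0 := by
  have hq0 : q ≠ 0 := NeZero.ne q
  subst hq
  have hx : x ≠ 0 := fun h ↦ hq0 (by rw [h, zero_mul])
  have hxZ : (x : ℤ) ≠ 0 := Nat.cast_ne_zero.mpr hx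
  have hqC : ((x * m : ℕ) : ℂ) ≠ 0 := Nat.cast_ne_zero.mpr hq0
  have hU1 : 1 - cexp (2 * π * I * ((-(2 * x) : ℤ) : ℂ) / ((x * m : ℕ) : ℂ)) ≠ 0 := by
    rw [sub_ne_zero, ne_comm, Ne, exp_intCast_eq_one_iff_x hq0, dvd_neg, Nat.cast_mul, mul_comm (2 : ℤ),
      mul_dvd_mul_iff_left hxZ]
    intro h
    have := Int.le_of_dvd two_pos h
    omega
  have hA1 : 1 - cexp (2 * π * I * ((x * (w - x) : ℤ) : ℂ) / ((x * m : ℕ) : ℂ)) ≠ 0 := by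
    rw [sub_ne_zero, ne_comm, Ne, exp_intCast_eq_one_iff_x hq0, Nat.cast_mul, mul_dvd_mul_iff_left hxZ]
    exact hm₁
  have hB1 : 1 - cexp (2 * π * I * ((x * (w + x) : ℤ) : ℂ) / ((x * m : ℕ) : ℂ)) ≠ 0 := by
    rw [sub_ne_zero, ne_comm, Ne, exp_intCast_eq_one_iff_x hq0, Nat.cast_mul, mul_dvd_mul_iff_left hxZ]
    exact hp₁
  have hAB : cexp (2 * π * I * ((x * (w - x) : ℤ) : ℂ) / ((x * m : ℕ) : ℂ)) ≠
      cexp (2 * π * I * ((x * (w + x) : ℤ) : ℂ) / ((x * m : ℕ) : ℂ)) := by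
    rw [Ne, exp_intCast_eq_iff_x hq0, ZMod.intCast_eq_intCast_iff_dvd_sub, Nat.cast_mul,
      show (x : ℤ) * (w + x) - x * (w - x) = x * (2 * x) by ring, mul_dvd_mul_iff_left hxZ]
    exact h2x
  refine mul_ne_zero (div_ne_zero two_ne_zero hqC) (mul_ne_zero (one_div_ne_zero hU1) ?_)
  intro h
  rw [sub_eq_zero, div_eq_div_iff hA1 hB1] at h
  have h' := mul_left_cancel₀ (Nat.cast_ne_zero.mpr hx : (x : ℂ) ≠ 0) h
  exact hAB (by linear_combination h')

/-! ### §6 THEOREM 3.1, Case 5, for two spaces in the normal form `L(q; x, w₁)`, `L(q; x, w₂)` -/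

/-- The algebra of Case 5: from `1/(1 − VŪ) − 1/(1 − VU) = 1/(1 − WŪ) − 1/(1 − WU)` with `UŪ = 1`, `U ≠ Ū` and no factor
zero: `(V − W)(1 − VW) = 0`. [cite: BariHunsicker2019, Theorem 3.1 (proof, Case 5)] -/
private theorem eq_or_mul_eq_one_x {V W U U' : ℂ} (hUU' : U * U' = 1) (hne : U ≠ U') (h1 : 1 - V * U' ≠ 0)
    (h2 : 1 - V * U ≠ 0) (h3 : 1 - W * U' ≠ 0) (h4 : 1 - W * U ≠ 0)
    (h : 1 / (1 - V * U') - 1 / (1 - V * U) = 1 / (1 - W * U') - 1 / (1 - W * U)) : V = W ∨ V * W = 1 := by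
  rw [div_sub_div _ _ h1 h2, div_sub_div _ _ h3 h4, div_eq_div_iff (mul_ne_zero h1 h2) (mul_ne_zero h3 h4)] at h
  have key : (V - W) * (1 - V * W) * (U' - U) = 0 := by
    linear_combination h + (V - W) * (U' - U) * V * W * hUU'
  rcases mul_eq_zero.mp key with h0 | h0
  · rcases mul_eq_zero.mp h0 with h0 | h0
    · exact Or.inl (sub_eq_zero.mp h0)
    · exact Or.inr (sub_eq_zero.mp h0).symm
  · exact absurd (sub_eq_zero.mp h0).symm hne

/-- **THEOREM 3.1 (Bari–Hunsicker 2019), Case 5, the congruence**: let `L₁ = L(q : x, w₁)` and `L₂ = L(q : x, w₂)` be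
orbifold lens spaces in the normal form of Lemma 3.3 (`q = xm`, `m ≥ 3`, `wᵢ` prime to `x`, `m ∤ lwᵢ − x` for all `l`,
`m ∤ 2x`; in the source `L₁ = L(q : x, py)`, `L₂ = L(q : x, sy)`). If `L₁` and `L₂` are isospectral then `w₁ ≡ w₂` or
`w₁ ≡ −w₂ (mod q/x)` — the residues at `γ^{−x}` agree, and with `V = e(xw₁)`, `W = e(xw₂)`, `U = e(x²)` their closed forms give
`(V − W)(1 − VW) = 0`. (The source reaches the corresponding congruences (test4)/(eq:case2) through the cotangent sums
(test3) and a comparison of their individual terms; the closed form makes that comparison unnecessary.)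
[cite: BariHunsicker2019, Theorem 3.1 (proof, Case 5: (test3), (test4), (eq:case2))] -/
theorem dvd_sub_or_dvd_add_of_lensMultiplicity_eq_axis {q x m : ℕ} [NeZero q] (hq : q = x * m) (hm : 3 ≤ m)
    (h2x : ¬ (m : ℤ) ∣ 2 * x) {w₁ w₂ : ℤ} (hw₁x : IsCoprime w₁ x) (hw₂x : IsCoprime w₂ x)
    (hw₁ : ∀ l : ℤ, ¬ (m : ℤ) ∣ l * w₁ - x) (hw₂ : ∀ l : ℤ, ¬ (m : ℤ) ∣ l * w₂ - x)
    (h : ∀ n : ℕ, lensMultiplicity q x w₁ n = lensMultiplicity q x w₂ n) :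
    (m : ℤ) ∣ w₁ - w₂ ∨ (m : ℤ) ∣ w₁ + w₂ := by
  have hq0 : q ≠ 0 := NeZero.ne q
  have t1 := tendsto_one_sub_exp_mul_tsum_lensMultiplicity_axis hq hm hw₁x hw₁
  have t2 := tendsto_one_sub_exp_mul_tsum_lensMultiplicity_axis hq hm hw₂x hw₂
  simp only [h] at t1
  haveI := (nhdsWithin_ball_le_and_neBot_x (norm_exp_intCast_x q (-(x : ℤ)))).2
  have e := tendsto_nhds_unique t1 t2
  subst hq
  have hx : x ≠ 0 := fun h ↦ hq0 (by rw [h, zero_mul])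
  have hxZ : (x : ℤ) ≠ 0 := Nat.cast_ne_zero.mpr hx
  have hxC : (x : ℂ) ≠ 0 := Nat.cast_ne_zero.mpr hx
  have hqC : ((x * m : ℕ) : ℂ) ≠ 0 := Nat.cast_ne_zero.mpr hq0
  have hU1 : 1 - cexp (2 * π * I * ((-(2 * x) : ℤ) : ℂ) / ((x * m : ℕ) : ℂ)) ≠ 0 := by
    rw [sub_ne_zero, ne_comm, Ne, exp_intCast_eq_one_iff_x hq0, dvd_neg, Nat.cast_mul, mul_comm (2 : ℤ),
      mul_dvd_mul_iff_left hxZ]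
    intro h
    have := Int.le_of_dvd two_pos h
    omega
  have e2 := mul_left_cancel₀ (one_div_ne_zero hU1) (mul_left_cancel₀ (div_ne_zero two_ne_zero hqC) e)
  -- no factor vanishes
  have hden : ∀ {w : ℤ} (a : ℤ), ¬ (m : ℤ) ∣ w + a →
      1 - cexp (2 * π * I * ((x * (w + a) : ℤ) : ℂ) / ((x * m : ℕ) : ℂ)) ≠ 0 := fun a ha ↦ by
    rw [sub_ne_zero, ne_comm, Ne, exp_intCast_eq_one_iff_x hq0, Nat.cast_mul, mul_dvd_mul_iff_left hxZ]
    exact ha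
  have hm₁ : ¬ (m : ℤ) ∣ w₁ + -x := by simpa [← sub_eq_add_neg] using hw₁ 1
  have hp₁ : ¬ (m : ℤ) ∣ w₁ + x := fun h' ↦
    hw₁ (-1) (by rw [show (-1 : ℤ) * w₁ - x = -(w₁ + x) by ring, dvd_neg]; exact h')
  have hm₂ : ¬ (m : ℤ) ∣ w₂ + -x := by simpa [← sub_eq_add_neg] using hw₂ 1
  have hp₂ : ¬ (m : ℤ) ∣ w₂ + x := fun h' ↦
    hw₂ (-1) (by rw [show (-1 : ℤ) * w₂ - x = -(w₂ + x) by ring, dvd_neg]; exact h')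
  have hA1 := hden (-(x : ℤ)) hm₁
  have hB1 := hden (x : ℤ) hp₁
  have hA2 := hden (-(x : ℤ)) hm₂
  have hB2 := hden (x : ℤ) hp₂
  simp only [← sub_eq_add_neg] at hA1 hA2
  -- divide by `x`
  have e3 : 1 / (1 - cexp (2 * π * I * ((x * (w₁ - x) : ℤ) : ℂ) / ((x * m : ℕ) : ℂ))) -
      1 / (1 - cexp (2 * π * I * ((x * (w₁ + x) : ℤ) : ℂ) / ((x * m : ℕ) : ℂ))) =
      1 / (1 - cexp (2 * π * I * ((x * (w₂ - x) : ℤ) : ℂ) / ((x * m : ℕ) : ℂ))) -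
      1 / (1 - cexp (2 * π * I * ((x * (w₂ + x) : ℤ) : ℂ) / ((x * m : ℕ) : ℂ))) := by
    have e2' := e2
    field_simp at e2' ⊢
    linear_combination e2'
  -- `e(x(w ∓ x)) = e(xw)·e(∓x²)`
  have hfac : ∀ (w a : ℤ), cexp (2 * π * I * ((x * (w + a) : ℤ) : ℂ) / ((x * m : ℕ) : ℂ)) =
      cexp (2 * π * I * ((x * w : ℤ) : ℂ) / ((x * m : ℕ) : ℂ)) * cexp (2 * π * I * ((x * a : ℤ) : ℂ) / ((x * m : ℕ) : ℂ)) :=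
    fun w a ↦ by rw [exp_intCast_mul_exp_intCast_x, mul_add]
  have hfac' : ∀ (w : ℤ), cexp (2 * π * I * ((x * (w - x) : ℤ) : ℂ) / ((x * m : ℕ) : ℂ)) =
      cexp (2 * π * I * ((x * w : ℤ) : ℂ) / ((x * m : ℕ) : ℂ)) *
        cexp (2 * π * I * ((x * -(x : ℤ) : ℤ) : ℂ) / ((x * m : ℕ) : ℂ)) :=
    fun w ↦ by rw [← hfac, ← sub_eq_add_neg]
  rw [hfac', hfac, hfac', hfac] at e3
  rw [hfac'] at hA1 hA2
  rw [hfac] at hB1 hB2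
  have hUU' : cexp (2 * π * I * ((x * (x : ℤ) : ℤ) : ℂ) / ((x * m : ℕ) : ℂ)) *
      cexp (2 * π * I * ((x * -(x : ℤ) : ℤ) : ℂ) / ((x * m : ℕ) : ℂ)) = 1 := by
    rw [exp_intCast_mul_exp_intCast_x, show (x : ℤ) * x + x * -(x : ℤ) = 0 by ring, Int.cast_zero, mul_zero, zero_div,
      Complex.exp_zero]
  have hne : cexp (2 * π * I * ((x * (x : ℤ) : ℤ) : ℂ) / ((x * m : ℕ) : ℂ)) ≠
      cexp (2 * π * I * ((x * -(x : ℤ) : ℤ) : ℂ) / ((x * m : ℕ) : ℂ)) := by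
    rw [Ne, exp_intCast_eq_iff_x hq0, ZMod.intCast_eq_intCast_iff_dvd_sub, Nat.cast_mul,
      show (x : ℤ) * -(x : ℤ) - x * x = x * -(2 * x) by ring, mul_dvd_mul_iff_left hxZ, dvd_neg]
    exact h2x
  rcases eq_or_mul_eq_one_x hUU' hne hA1 hB1 hA2 hB2 e3 with hV | hV
  · refine Or.inl ?_
    have hV' := (exp_intCast_eq_iff_x hq0 _ _).mp hV
    rw [ZMod.intCast_eq_intCast_iff_dvd_sub, Nat.cast_mul, ← mul_sub, mul_dvd_mul_iff_left hxZ] at hV'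
    rw [show w₁ - w₂ = -(w₂ - w₁) by ring, dvd_neg]
    exact hV'
  · refine Or.inr ?_
    rw [exp_intCast_mul_exp_intCast_x, exp_intCast_eq_one_iff_x hq0, Nat.cast_mul, ← mul_add,
      mul_dvd_mul_iff_left hxZ] at hV
    exact hV

/-- **From the congruence to the isometry (Corollary 2.2)**: if `w₁ ≡ ±w₂ (mod m)`, `q = xm`, and `w₁, w₂` are prime to `x`,
then there is `l` prime to `q` with `lx ≡ x` and `lw₂ ≡ ±w₁ (mod q)` — namely `l = 1 + tm` with `t ≡ ((w₁ ∓ w₂)/m)·w₂⁻¹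
(mod x)` (the source's `L(q; x, py) ~ L(q; −x, −py) ~ L(q; −x, (t₃q/x ∓ 1)sy) ~ L(q; x, sy)`).
[cite: BariHunsicker2019, Theorem 3.1 (proof, Case 5, final step), Corollary 2.2] -/
theorem exists_isCoprime_mul_congr_axis {q x m : ℕ} (hq : q = x * m) {w₁ w₂ : ℤ} (hw₁x : IsCoprime w₁ x)
    (hw₂x : IsCoprime w₂ x) (h : (m : ℤ) ∣ w₁ - w₂ ∨ (m : ℤ) ∣ w₁ + w₂) :
    ∃ l : ℤ, IsCoprime l q ∧ ∃ e : ℤ, (e = 1 ∨ e = -1) ∧ l * x ≡ x [ZMOD q] ∧ l * w₂ ≡ e * w₁ [ZMOD q] := by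
  subst hq
  obtain ⟨u, v, huv⟩ := hw₂x
  -- `l = 1 + tm` with `x ∣ t w₂ − d` (resp. `+ d`), `d = (w₁ ∓ w₂)/m`
  have main : ∀ (e d : ℤ), (e = 1 ∨ e = -1) → e * w₁ - w₂ = m * d →
      ∃ l : ℤ, IsCoprime l ((x * m : ℕ) : ℤ) ∧ ∃ e : ℤ, (e = 1 ∨ e = -1) ∧
        l * x ≡ x [ZMOD ((x * m : ℕ) : ℤ)] ∧ l * w₂ ≡ e * w₁ [ZMOD ((x * m : ℕ) : ℤ)] := by
    intro e d he hd
    have he2 : e * e = 1 := by rcases he with rfl | rfl <;> norm_num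
    refine ⟨1 + u * d * m, ?_, e, he, ?_, ?_⟩
    · rw [Nat.cast_mul]
      refine IsCoprime.mul_right ?_ ⟨1, -(u * d), by ring⟩
      -- `l w₂ ≡ e w₁ (mod x)` and `w₁` is prime to `x`
      have h1 : (1 + u * d * m) * w₂ = e * w₁ + x * (-(m * d * v)) := by
        linear_combination (m * d) * huv - hd
      have h2 : IsCoprime ((1 + u * d * m) * w₂) x := by
        rw [h1]
        refine IsCoprime.add_mul_left_left ?_ _
        rcases he with rfl | rfl
        · rwa [one_mul]
        · rw [neg_one_mul]; exact hw₁x.neg_left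
      exact h2.of_mul_left_left
    · rw [Nat.cast_mul]
      exact Int.modEq_iff_dvd.mpr ⟨-(u * d), by ring⟩
    · rw [Nat.cast_mul]
      exact Int.modEq_iff_dvd.mpr ⟨d * v, by linear_combination (-(m * d)) * huv + hd⟩
  rcases h with ⟨d, hd⟩ | ⟨d, hd⟩
  · exact main 1 d (Or.inl rfl) (by rw [one_mul, hd])
  · exact main (-1) (-d) (Or.inr rfl) (by linear_combination -hd)

/-- **THEOREM 3.1 (Bari–Hunsicker 2019), Case 5, in the normal form `L₁ = L(q : x, w₁)`, `L₂ = L(q : x, w₂)`**: such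
isospectral orbifold lens spaces are ISOMETRIC — there is `l` prime to `q` and a sign `e` with `(x, w₁) ≡ (lx, elw₂) (mod q)`,
the criterion of Corollary 2.2. Hypotheses: `q = xm`, `m ≥ 3`, `m ∤ 2x`, `wᵢ` prime to `x`, `m ∤ lwᵢ − x` for all `l` (for
`L(q : x, py)` of the source these say `y ∤ x`, `y ∤ 2x`, `gcd(x, py) = 1`). [cite: BariHunsicker2019, Theorem 3.1 (Case 5),
Corollary 2.2] -/
theorem exists_isCoprime_mul_congr_of_lensMultiplicity_eq_axis {q x m : ℕ} [NeZero q] (hq : q = x * m) (hm : 3 ≤ m)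
    (h2x : ¬ (m : ℤ) ∣ 2 * x) {w₁ w₂ : ℤ} (hw₁x : IsCoprime w₁ x) (hw₂x : IsCoprime w₂ x)
    (hw₁ : ∀ l : ℤ, ¬ (m : ℤ) ∣ l * w₁ - x) (hw₂ : ∀ l : ℤ, ¬ (m : ℤ) ∣ l * w₂ - x)
    (h : ∀ n : ℕ, lensMultiplicity q x w₁ n = lensMultiplicity q x w₂ n) :
    ∃ l : ℤ, IsCoprime l q ∧ ∃ e : ℤ, (e = 1 ∨ e = -1) ∧ l * x ≡ x [ZMOD q] ∧ l * w₂ ≡ e * w₁ [ZMOD q] :=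
  exists_isCoprime_mul_congr_axis hq hw₁x hw₂x
    (dvd_sub_or_dvd_add_of_lensMultiplicity_eq_axis hq hm h2x hw₁x hw₂x hw₁ hw₂ h)

/-- **… and Ikeda's criterion `LensWeightsEquivalent q (x, w₁) (x, w₂)`** (`σ = id`, signs `(1, e)`, multiplier `l`).
[cite: BariHunsicker2019, Theorem 3.1 (Case 5), Corollary 2.2] [cite: Ikeda1980, Theorem 2.1 (4)] -/
theorem lensWeightsEquivalent_of_lensMultiplicity_eq_axis {q x m : ℕ} [NeZero q] (hq : q = x * m) (hm : 3 ≤ m)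
    (h2x : ¬ (m : ℤ) ∣ 2 * x) {w₁ w₂ : ℤ} (hw₁x : IsCoprime w₁ x) (hw₂x : IsCoprime w₂ x)
    (hw₁ : ∀ l : ℤ, ¬ (m : ℤ) ∣ l * w₁ - x) (hw₂ : ∀ l : ℤ, ¬ (m : ℤ) ∣ l * w₂ - x)
    (h : ∀ n : ℕ, lensMultiplicity q x w₁ n = lensMultiplicity q x w₂ n) :
    LensWeightsEquivalent q ![(x : ℤ), w₁] ![(x : ℤ), w₂] := by
  obtain ⟨l, -, e, he, h1, h2⟩ := exists_isCoprime_mul_congr_of_lensMultiplicity_eq_axis hq hm h2x hw₁x hw₂x hw₁ hw₂ h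
  have he2 : e * e = 1 := by rcases he with rfl | rfl <;> norm_num
  refine ⟨l, ![1, e], fun i ↦ ?_, Equiv.refl _, fun i ↦ ?_⟩
  · fin_cases i
    · exact Or.inl rfl
    · simpa using he
  · fin_cases i
    · simpa using h1.symm
    · simp only [Equiv.refl_apply, Fin.mk_one, Matrix.cons_val_one, Matrix.cons_val_zero]
      calc w₁ = e * (e * w₁) := by rw [← mul_assoc, he2, one_mul]
        _ ≡ e * (l * w₂) [ZMOD q] := (h2.symm.mul_left e)
        _ = e * l * w₂ := by ring

end Literature.Analysis.InnerProduct
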